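import Literature.NumberTheory.IwasawaTheory.CyclotomicTwoLayerTwoNegOneNorm
import Literature.NumberTheory.NumberFields.UnitNormIndexOneOfRankOne
import HarnessLib

/-!
# The NORM FORM of the quartic layer `K_2 = K(θ)`, `θ⁴ − 4θ² + 2 = 0`, of the cyclotomic `ℤ₂`-extension of an odd-degree number field:
# `N_{K(θ)/K}(a + bθ + cθ² + dθ³) = F(a,b,c,d)` explicitly, and the unit-norm-index hypothesis of the depth door in IDENTITY currency

Topic `NumberTheory/IwasawaTheory` (namespace = path).  THEOREM-ONLY file (no definition, no named fact, no instance, no `sorry`), written by the prover seat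
`bsd-line-att-p3` g43 (cell `bsd-f1-sign2`, route `AlignedTransportAtTwo`; `--supports` stmt-BirchSwinnertonDyer-22298, closes nothing).  Sequel of att-p3 g42's
`CyclotomicTwoLayerTwoNegOneNorm` (`N(1 − θ) = −1`) and `NumberFields/UnitNormIndexOneOfRankOne` (index one from `−1`, `ε` norms and `±ε` non-squares): here
the norm of a GENERAL element of `K(θ)` is written out, so that the remaining displayed hypothesis `[E_K : E_K ∩ N_{K_2/K} K_2ˣ] = 1` of the depth door
(`ClassGroupPRankLeOneOfAmbiguousLayerTwo`, g42) becomes ONE polynomial identity in `K` plus two non-square residues.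

THE FORM.  For `θ⁴ = 4θ² − 2` the four conjugates of `θ` in `K(θ)` are `±θ`, `±θ′` with `θ′ = θ³ − 3θ` (`θ′² = 4 − θ²`, `θ²θ′² = 2`), and for
`x = a + bθ + cθ² + dθ³`:
  `N(x) = [(a + cθ²)² − θ²(b + dθ²)²]·[(a + cθ′²)² − θ′²(b + dθ′²)²] = F(a,b,c,d)`,
  `F(a,b,c,d) = a⁴ + 8a³c − 4a²b² − 24a²bd + 20a²c² − 40a²d² − 8ab²c − 32abcd + 16ac³ − 48acd² + 2b⁴ + 16b³d − 8b²c² + 40b²d² − 16bc²d + 32bd³ + 4c⁴ − 16c²d² + 8d⁴`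
(check: `F(1,−1,0,0) = 1 − 4 + 2 = −1 = N(1 − θ)`; `F(a,0,0,0) = a⁴`).

* §1 the roots: `(θ³ − 3θ)² = 4 − θ²`; `r⁴ − 4r² + 2 = (r−θ)(r+θ)(r−θ′)(r+θ′)`; the four roots are pairwise distinct (characteristic `0`).
* §2 the Galois group of `K(θ)/K` (`[K:ℚ]` odd, `L/K` Galois of degree `4` with a root `θ`): `σ ↦ σθ` is injective with image `{θ, −θ, θ′, −θ′}`, so
  `∏_σ f(σθ) = f(θ)f(−θ)f(θ′)f(−θ′)` for any `f : L → L`.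
* §3 ★★ `Algebra.norm_quartic_layer_eq_normForm` — `N_{L/K}(a + bθ + cθ² + dθ³) = F(a,b,c,d)`.
* §4 ★★ `mem_map_norm_layer_two_of_normForm_eq` (every `u ∈ Kˣ` of the form `F(a,b,c,d)` is a norm from `K_2`, Chevalley currency) and ★★★
  `relIndex_unitsNorm_layer_two_eq_one_of_normForm_eq` — `K` of odd degree and unit rank `1`, `κ` cyclotomic, a unit `ε` with `F(a,b,c,d) = ε` for some
  `a,b,c,d ∈ K` and `±ε` non-squares in `E_K` ⟹ **`[E_K : E_K ∩ N_{K_2/K} K_2ˣ] = 1`** (with g42's `neg_one_mem_map_norm_layer_two` and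
  `relIndex_unitsNorm_eq_one_of_rank_eq_one`).

HONEST SCOPE: classical (norms in a cyclic quartic extension; `ℚ(θ) = ℚ(ζ₁₆)⁺`); nothing specific to any summit; no identity for any particular field is
asserted (finding `a,b,c,d` with `F(a,b,c,d) = ε` is a norm-equation computation per field, e.g. PARI `bnfisnorm`); BSD is not advanced by this file.

References: [Washington1997] §13.1 (`K_n = K·ℚ_n`, `ℚ_2 = ℚ(ζ₁₆)⁺ = ℚ(√(2+√2))`), §9; [Lang1990] Ch. 13 §4 Lemma 4.1 (the unit norm index); [NeukirchANT1999]
Ch. I §2 Prop. (2.6) (norm = product of conjugates), Ch. IV §1; [Omeara1963] §63B.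
-/

set_option autoImplicit false

noncomputable section

open scoped NumberField IntermediateField
open NumberField Field

namespace Literature.NumberTheory.IwasawaTheory

open Literature.NumberTheory.EllipticCurves Literature.NumberTheory.NumberFields Literature.NumberTheory.NumberFields.AmbiguousClass
  Literature.NumberTheory.GaloisRepresentations Literature.NumberTheory.GaloisRepresentations.Herbrand
  Literature.NumberTheory.GaloisRepresentations.MinkowskiUnit Literature.NumberTheory.GaloisRepresentations.CyclicNormIndex

/-! ## §1 The four roots `±θ`, `±(θ³ − 3θ)` -/

section Roots

variable {L : Type*} [Field L]

/-- `θ′ = θ³ − 3θ` satisfies `θ′² = 4 − θ²` when `θ⁴ − 4θ² + 2 = 0`. [cite: Washington1997, §13.1 (`ℚ_2 = ℚ(ζ₁₆)⁺`: `2cos(π/8)`, `2cos(3π/8)`)] -/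
theorem conj_root_sq_eq {θ : L} (hθ : θ ^ 4 - 4 * θ ^ 2 + 2 = 0) : (θ ^ 3 - 3 * θ) ^ 2 = 4 - θ ^ 2 := by
  linear_combination (θ ^ 2 - 2) * hθ

/-- `r⁴ − 4r² + 2 = (r − θ)(r + θ)(r − θ′)(r + θ′)` with `θ′ = θ³ − 3θ`: the quartic splits in `K(θ)`. [cite: Washington1997, §13.1] -/
theorem quartic_eq_prod_roots {θ : L} (hθ : θ ^ 4 - 4 * θ ^ 2 + 2 = 0) (r : L) :
    r ^ 4 - 4 * r ^ 2 + 2 = (r - θ) * (r + θ) * (r - (θ ^ 3 - 3 * θ)) * (r + (θ ^ 3 - 3 * θ)) := by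
  linear_combination ((θ ^ 2 - 2) * r ^ 2 - θ ^ 4 + 2 * θ ^ 2 + 1) * hθ

/-- Every root of `X⁴ − 4X² + 2` in a field containing `θ` is one of `θ, −θ, θ′, −θ′`. [cite: Washington1997, §13.1] -/
theorem eq_or_eq_of_quartic_root {θ : L} (hθ : θ ^ 4 - 4 * θ ^ 2 + 2 = 0) {r : L} (hr : r ^ 4 - 4 * r ^ 2 + 2 = 0) :
    r = θ ∨ r = -θ ∨ r = θ ^ 3 - 3 * θ ∨ r = -(θ ^ 3 - 3 * θ) := by
  rw [quartic_eq_prod_roots hθ r] at hr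
  rcases mul_eq_zero.mp hr with h | h
  · rcases mul_eq_zero.mp h with h | h
    · rcases mul_eq_zero.mp h with h | h
      · exact Or.inl (sub_eq_zero.mp h)
      · exact Or.inr (Or.inl (eq_neg_of_add_eq_zero_left h))
    · exact Or.inr (Or.inr (Or.inl (sub_eq_zero.mp h)))
  · exact Or.inr (Or.inr (Or.inr (eq_neg_of_add_eq_zero_left h)))

variable [CharZero L]

/-- `θ ≠ 0`. [folklore] -/
private theorem root_ne_zero {θ : L} (hθ : θ ^ 4 - 4 * θ ^ 2 + 2 = 0) : θ ≠ 0 := by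
  rintro rfl; norm_num at hθ

/-- The four roots `θ, −θ, θ′, −θ′` are pairwise distinct (characteristic `0`). [cite: Washington1997, §13.1] -/
theorem roots_pairwise_ne {θ : L} (hθ : θ ^ 4 - 4 * θ ^ 2 + 2 = 0) :
    θ ≠ -θ ∧ θ ≠ θ ^ 3 - 3 * θ ∧ θ ≠ -(θ ^ 3 - 3 * θ) ∧ -θ ≠ θ ^ 3 - 3 * θ ∧ -θ ≠ -(θ ^ 3 - 3 * θ) ∧
      θ ^ 3 - 3 * θ ≠ -(θ ^ 3 - 3 * θ) := by
  have h0 := root_ne_zero hθ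
  -- `θ² ≠ 4`, `θ² ≠ 2`, `θ² ≠ 3`
  have h4 : θ ^ 2 ≠ 4 := fun h => by
    have : θ ^ 4 = 16 := by rw [show θ ^ 4 = (θ ^ 2) ^ 2 by ring, h]; norm_num
    rw [this, h] at hθ; norm_num at hθ
  have h2 : θ ^ 2 ≠ 2 := fun h => by
    have : θ ^ 4 = 4 := by rw [show θ ^ 4 = (θ ^ 2) ^ 2 by ring, h]; norm_num
    rw [this, h] at hθ; norm_num at hθ
  have h3 : θ ^ 2 ≠ 3 := fun h => by
    have : θ ^ 4 = 9 := by rw [show θ ^ 4 = (θ ^ 2) ^ 2 by ring, h]; norm_num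
    rw [this, h] at hθ; norm_num at hθ
  refine ⟨?_, ?_, ?_, ?_, ?_, ?_⟩
  · intro h
    have : (2 : L) * θ = 0 := by linear_combination h
    exact h0 (by simpa using this)
  · intro h
    have : θ * (θ ^ 2 - 4) = 0 := by linear_combination -h
    rcases mul_eq_zero.mp this with h' | h'
    · exact h0 h'
    · exact h4 (sub_eq_zero.mp h')
  · intro h
    have : θ * (θ ^ 2 - 2) = 0 := by linear_combination h
    rcases mul_eq_zero.mp this with h' | h'
    · exact h0 h'
    · exact h2 (sub_eq_zero.mp h')
  · intro h
    have : θ * (θ ^ 2 - 2) = 0 := by linear_combination -h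
    rcases mul_eq_zero.mp this with h' | h'
    · exact h0 h'
    · exact h2 (sub_eq_zero.mp h')
  · intro h
    have : θ * (θ ^ 2 - 4) = 0 := by linear_combination h
    rcases mul_eq_zero.mp this with h' | h'
    · exact h0 h'
    · exact h4 (sub_eq_zero.mp h')
  · intro h
    have : (2 : L) * (θ * (θ ^ 2 - 3)) = 0 := by linear_combination h
    rcases mul_eq_zero.mp this with h' | h'
    · norm_num at h'
    · rcases mul_eq_zero.mp h' with h'' | h''
      · exact h0 h''
      · exact h3 (sub_eq_zero.mp h'')

end Roots

/-! ## §2 The Galois group of `K(θ)/K` acts simply transitively on the four roots -/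

section Galois

variable {K : Type} [Field K] [NumberField K] {L : Type*} [Field L] [Algebra K L] [FiniteDimensional K L] [IsGalois K L]

/-- For `[K:ℚ]` odd and `θ ∈ L` a root of `X⁴ − 4X² + 2` with `[L:K] = 4`: two `K`-automorphisms of `L` agreeing on `θ` are equal (`L = K(θ)`, tree
`finrank_adjoin_quartic_root`). [cite: Washington1997, §13.1] -/
theorem algEquiv_eq_of_apply_root_eq (hodd : Odd (Module.finrank ℚ K)) (hL : Module.finrank K L = 4) {θ : L}
    (hθ : θ ^ 4 - 4 * θ ^ 2 + 2 = 0) {σ τ : L ≃ₐ[K] L} (h : σ θ = τ θ) : σ = τ := by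
  have hint : IsIntegral K θ := Algebra.IsIntegral.isIntegral θ
  have htop : K⟮θ⟯ = ⊤ := by
    apply IntermediateField.eq_of_le_of_finrank_eq le_top
    rw [finrank_adjoin_quartic_root hodd θ hθ, IntermediateField.finrank_top', hL]
  have hadj : Algebra.adjoin K {θ} ≤ AlgHom.equalizer (σ : L →ₐ[K] L) (τ : L →ₐ[K] L) := by
    rw [Algebra.adjoin_le_iff, Set.singleton_subset_iff]
    exact h
  ext x
  have hx : x ∈ K⟮θ⟯.toSubalgebra := by rw [htop]; exact Algebra.mem_top
  rw [IntermediateField.adjoin_simple_toSubalgebra_of_isAlgebraic hint.isAlgebraic] at hx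
  exact (AlgHom.mem_equalizer _ _ x).mp (hadj hx)

/-- **`∏_{σ ∈ Gal(L/K)} f(σθ) = f(θ)·f(−θ)·f(θ′)·f(−θ′)`** for any `f : L → L`: the map `σ ↦ σθ` is a bijection of `Gal(L/K)` onto the four roots.
[cite: Washington1997, §13.1] [cite: NeukirchANT1999, Ch. IV §1] -/
theorem prod_algEquiv_apply_root_eq (hodd : Odd (Module.finrank ℚ K)) (hL : Module.finrank K L = 4) {θ : L}
    (hθ : θ ^ 4 - 4 * θ ^ 2 + 2 = 0) (f : L → L) :
    ∏ σ : L ≃ₐ[K] L, f (σ θ) = f θ * f (-θ) * f (θ ^ 3 - 3 * θ) * f (-(θ ^ 3 - 3 * θ)) := by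
  classical
  have hcard : (Finset.univ : Finset (L ≃ₐ[K] L)).card = 4 := by
    rw [Finset.card_univ, ← Nat.card_eq_fintype_card, IsGalois.card_aut_eq_finrank, hL]
  have hinj : Function.Injective (fun σ : L ≃ₐ[K] L => σ θ) := fun σ τ h => algEquiv_eq_of_apply_root_eq hodd hL hθ h
  set S : Finset L := {θ, -θ, θ ^ 3 - 3 * θ, -(θ ^ 3 - 3 * θ)} with hS
  have hsub : Finset.univ.image (fun σ : L ≃ₐ[K] L => σ θ) ⊆ S := by
    intro r hr
    obtain ⟨σ, -, rfl⟩ := Finset.mem_image.mp hr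
    have hσ : (σ θ) ^ 4 - 4 * (σ θ) ^ 2 + 2 = 0 := by
      have := congrArg σ hθ
      simpa [map_sub, map_add, map_pow, map_mul, map_ofNat] using this
    rcases eq_or_eq_of_quartic_root hθ hσ with h | h | h | h <;> simp [hS, h]
  have hSle : S.card ≤ 4 := by
    rw [hS]
    refine (Finset.card_insert_le _ _).trans ?_
    refine Nat.succ_le_succ ((Finset.card_insert_le _ _).trans ?_)
    refine Nat.succ_le_succ ((Finset.card_insert_le _ _).trans ?_)
    rw [Finset.card_singleton]
  have himg : Finset.univ.image (fun σ : L ≃ₐ[K] L => σ θ) = S := by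
    apply Finset.eq_of_subset_of_card_le hsub
    rw [Finset.card_image_of_injective _ hinj, hcard]
    exact hSle
  rw [← Finset.prod_image (fun σ _ τ _ h => hinj h), himg, hS]
  haveI : CharZero L := charZero_of_injective_algebraMap (algebraMap K L).injective
  obtain ⟨h1, h2, h3, h4, h5, h6⟩ := roots_pairwise_ne (L := L) hθ
  rw [Finset.prod_insert (by simp only [Finset.mem_insert, Finset.mem_singleton, not_or]; exact ⟨h1, h2, h3⟩),
    Finset.prod_insert (by simp only [Finset.mem_insert, Finset.mem_singleton, not_or]; exact ⟨h4, h5⟩), Finset.prod_pair h6]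
  ring

end Galois

/-! ## §3 The norm form -/

section NormForm

variable {K : Type} [Field K] [NumberField K] {L : Type*} [Field L] [Algebra K L] [FiniteDimensional K L] [IsGalois K L]

/-- ★★ **THE NORM FORM OF `K(θ)/K`, `θ⁴ − 4θ² + 2 = 0`.**  `[K:ℚ]` odd, `L/K` Galois of degree `4`, `θ ∈ L` a root; for `a, b, c, d ∈ K`:
`N_{L/K}(a + bθ + cθ² + dθ³) = a⁴ + 8a³c − 4a²b² − 24a²bd + 20a²c² − 40a²d² − 8ab²c − 32abcd + 16ac³ − 48acd² + 2b⁴ + 16b³d − 8b²c² + 40b²d² − 16bc²d + 32bd³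
+ 4c⁴ − 16c²d² + 8d⁴` (`= [(a+cθ²)² − θ²(b+dθ²)²]·[(a+cθ′²)² − θ′²(b+dθ′²)]`, `θ′² = 4 − θ²`, reduced with `θ⁴ = 4θ² − 2`).
[cite: NeukirchANT1999, Ch. I §2 Prop. (2.6) (norm as product of conjugates)] [cite: Washington1997, §13.1] -/
theorem Algebra.norm_quartic_layer_eq_normForm (hodd : Odd (Module.finrank ℚ K)) (hL : Module.finrank K L = 4) {θ : L}
    (hθ : θ ^ 4 - 4 * θ ^ 2 + 2 = 0) (a b c d : K) :
    Algebra.norm K (algebraMap K L a + algebraMap K L b * θ + algebraMap K L c * θ ^ 2 + algebraMap K L d * θ ^ 3) =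
      a ^ 4 + 8 * a ^ 3 * c - 4 * a ^ 2 * b ^ 2 - 24 * a ^ 2 * b * d + 20 * a ^ 2 * c ^ 2 - 40 * a ^ 2 * d ^ 2
        - 8 * a * b ^ 2 * c - 32 * a * b * c * d + 16 * a * c ^ 3 - 48 * a * c * d ^ 2 + 2 * b ^ 4 + 16 * b ^ 3 * d
        - 8 * b ^ 2 * c ^ 2 + 40 * b ^ 2 * d ^ 2 - 16 * b * c ^ 2 * d + 32 * b * d ^ 3 + 4 * c ^ 4 - 16 * c ^ 2 * d ^ 2
        + 8 * d ^ 4 := by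
  classical
  set A := algebraMap K L a with hA
  set B := algebraMap K L b with hB
  set C := algebraMap K L c with hC
  set D := algebraMap K L d with hD
  set f : L → L := fun r => A + B * r + C * r ^ 2 + D * r ^ 3 with hf
  apply (algebraMap K L).injective
  have hσ : ∀ σ : L ≃ₐ[K] L, σ (A + B * θ + C * θ ^ 2 + D * θ ^ 3) = f (σ θ) := by
    intro σ
    simp only [hf, hA, hB, hC, hD, map_add, map_mul, map_pow, AlgEquiv.commutes]
  rw [Algebra.norm_eq_prod_automorphisms, Finset.prod_congr rfl fun σ _ => hσ σ, prod_algEquiv_apply_root_eq hodd hL hθ f]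
  have h3 : (θ ^ 3 - 3 * θ) ^ 2 = 4 - θ ^ 2 := conj_root_sq_eq hθ
  have e1 : f θ * f (-θ) = (A + C * θ ^ 2) ^ 2 - θ ^ 2 * (B + D * θ ^ 2) ^ 2 := by simp only [hf]; ring
  have e2 : f (θ ^ 3 - 3 * θ) * f (-(θ ^ 3 - 3 * θ)) =
      (A + C * (θ ^ 3 - 3 * θ) ^ 2) ^ 2 - (θ ^ 3 - 3 * θ) ^ 2 * (B + D * (θ ^ 3 - 3 * θ) ^ 2) ^ 2 := by
    simp only [hf]; ring
  rw [h3] at e2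
  rw [mul_assoc, e2, e1]
  simp only [map_add, map_sub, map_mul, map_pow, map_ofNat, ← hA, ← hB, ← hC, ← hD]
  linear_combination ((-4*D^4 + 8*C^2*D^2 - 2*C^4 - 16*B*D^3 + 8*B*C^2*D - 20*B^2*D^2 + 4*B^2*C^2 - 8*B^3*D - B^4
      + 24*A*C*D^2 - 8*A*C^3 + 16*A*B*C*D + 4*A*B^2*C - 12*A^2*D^2 - 2*A^2*C^2 - 4*A^2*B*D)
    + (-8*D^4 + 16*C^2*D^2 - 4*C^4 - 32*B*D^3 + 16*B*C^2*D - 8*B^2*D^2 - 16*A*C*D^2) * θ ^ 2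
    + (-14*D^4 - 4*C^2*D^2 + C^4 + 8*B*D^3 - 4*B*C^2*D + 2*B^2*D^2 + 4*A*C*D^2) * θ ^ 4
    + (8*D^4) * θ ^ 6 + (-D^4) * θ ^ 8) * hθ

end NormForm

/-! ## §4 Chevalley currency: norms from `K_2` and the unit norm index -/

section Layer

variable {K : Type} [Field K] [NumberField K]

/-- ★★ **An element of `K` represented by the norm form is a norm from `K_2`.**  `2 ∤ [K:ℚ]`, `κ` a cyclotomic `ℤ₂`-extension of `K`; if `u ∈ K`, `u ≠ 0`,
equals `F(a,b,c,d)` for some `a,b,c,d ∈ K` then `unitsIncl K K_2 u` lies in the image of `Herbrand.norm Gal(K_2/K)` on `K_2ˣ` (witness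
`a + bθ + cθ² + dθ³` for any root `θ ∈ K_2` of `X⁴ − 4X² + 2`, tree `exists_quartic_root_layer_two_of_not_dvd_finrank`).
[cite: Washington1997, §13.1] [cite: Lang1990, Ch. 13 §4, Lemma 4.1 (the unit norm index)] -/
theorem mem_map_norm_layer_two_of_normForm_eq (hK : ¬ 2 ∣ Module.finrank ℚ K) (κ : ZpExtension K 2) (hκ : κ.IsCyclotomic)
    [NumberField (κ.layer 2)] {u : K} (hu : u ≠ 0) (a b c d : K)
    (h : a ^ 4 + 8 * a ^ 3 * c - 4 * a ^ 2 * b ^ 2 - 24 * a ^ 2 * b * d + 20 * a ^ 2 * c ^ 2 - 40 * a ^ 2 * d ^ 2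
        - 8 * a * b ^ 2 * c - 32 * a * b * c * d + 16 * a * c ^ 3 - 48 * a * c * d ^ 2 + 2 * b ^ 4 + 16 * b ^ 3 * d
        - 8 * b ^ 2 * c ^ 2 + 40 * b ^ 2 * d ^ 2 - 16 * b * c ^ 2 * d + 32 * b * d ^ 3 + 4 * c ^ 4 - 16 * c ^ 2 * d ^ 2
        + 8 * d ^ 4 = u) :
    unitsIncl K (κ.layer 2) (Units.mk0 u hu) ∈
      (⊤ : Subgroup (κ.layer 2)ˣ).map (Herbrand.norm ((κ.layer 2) ≃ₐ[K] (κ.layer 2))) := by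
  classical
  haveI : IsGalois K (κ.layer 2) := κ.isGalois_layer_holds 2
  have hodd : Odd (Module.finrank ℚ K) := Nat.odd_iff.mpr (Nat.two_dvd_ne_zero.mp hK)
  have hL : Module.finrank K (κ.layer 2) = 4 := by rw [κ.finrank_layer_holds 2]; norm_num
  obtain ⟨θ, hθ⟩ := exists_quartic_root_layer_two_of_not_dvd_finrank hK κ hκ
  set x : κ.layer 2 := algebraMap K _ a + algebraMap K _ b * θ + algebraMap K _ c * θ ^ 2 + algebraMap K _ d * θ ^ 3 with hx
  have hnorm : Algebra.norm K x = u := by rw [hx, Algebra.norm_quartic_layer_eq_normForm hodd hL hθ, h]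
  have hne : x ≠ 0 := by
    intro h0
    have : Algebra.norm K x = 0 := by rw [h0, Algebra.norm_zero]
    rw [hnorm] at this
    exact hu this
  refine ⟨Units.mk0 _ hne, Subgroup.mem_top _, ?_⟩
  apply Units.ext
  rw [Herbrand.norm_apply, Units.coe_prod]
  simp only [val_smul, Units.val_mk0, coe_unitsIncl]
  rw [← Algebra.norm_eq_prod_automorphisms, hnorm]

/-- ★★★ **THE UNIT NORM INDEX OF THE QUARTIC LAYER IS `1` FROM ONE NORM-FORM IDENTITY.**  `K` of odd degree and unit rank `1` (complex cubic fields),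
`κ` a cyclotomic `ℤ₂`-extension, `ε` a unit of `K` with `F(a,b,c,d) = ε` for some `a,b,c,d ∈ K` and such that neither `ε` nor `−ε` is the square of a
unit.  THEN `[E_K : E_K ∩ N_{K_2/K} K_2ˣ] = 1` in Chevalley's currency — the hypothesis `hidx` of the depth door.  (`−1 = N(1 − θ)` is always a norm:
att-p3 g42's `neg_one_mem_map_norm_layer_two`; then `relIndex_unitsNorm_eq_one_of_rank_eq_one`.) [cite: Lang1990, Ch. 13 §4, Lemma 4.1–4.2 (PDF pp. 203–204)]
[cite: Washington1997, §13.1 and §13.3 Prop. 13.22] [cite: NeukirchANT1999, Ch. I §7 Thm. (7.4)] -/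
theorem relIndex_unitsNorm_layer_two_eq_one_of_normForm_eq (hK : ¬ 2 ∣ Module.finrank ℚ K) (hrank : Units.rank K = 1)
    (κ : ZpExtension K 2) (hκ : κ.IsCyclotomic) [NumberField (κ.layer 2)] {ε : (𝓞 K)ˣ} (a b c d : K)
    (h : a ^ 4 + 8 * a ^ 3 * c - 4 * a ^ 2 * b ^ 2 - 24 * a ^ 2 * b * d + 20 * a ^ 2 * c ^ 2 - 40 * a ^ 2 * d ^ 2
        - 8 * a * b ^ 2 * c - 32 * a * b * c * d + 16 * a * c ^ 3 - 48 * a * c * d ^ 2 + 2 * b ^ 4 + 16 * b ^ 3 * d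
        - 8 * b ^ 2 * c ^ 2 + 40 * b ^ 2 * d ^ 2 - 16 * b * c ^ 2 * d + 32 * b * d ^ 3 + 4 * c ^ 4 - 16 * c ^ 2 * d ^ 2
        + 8 * d ^ 4 = ((ε : 𝓞 K) : K))
    (hnsq : ∀ y : (𝓞 K)ˣ, ε ≠ y ^ 2 ∧ ε ≠ -y ^ 2) :
    (unitsE (κ.layer 2) ⊓ (⊤ : Subgroup (κ.layer 2)ˣ).map
        (Herbrand.norm ((κ.layer 2) ≃ₐ[K] (κ.layer 2)))).relIndex
      (unitsE (κ.layer 2) ⊓ (unitsIncl K (κ.layer 2)).range) = 1 := by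
  classical
  haveI : IsGalois K (κ.layer 2) := κ.isGalois_layer_holds 2
  have hodd : Odd (Module.finrank ℚ K) := Nat.odd_iff.mpr (Nat.two_dvd_ne_zero.mp hK)
  have hL : Module.finrank K (κ.layer 2) = 4 := by rw [κ.finrank_layer_holds 2]; norm_num
  have hεK : ((ε : 𝓞 K) : K) ≠ 0 := by
    rw [Ne, RingOfIntegers.coe_eq_zero_iff]; exact ε.ne_zero
  have hmem := mem_map_norm_layer_two_of_normForm_eq hK κ hκ hεK a b c d h
  have heq : unitsIncl K (κ.layer 2) (Units.map (algebraMap (𝓞 K) K : 𝓞 K →* K) ε) =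
      unitsIncl K (κ.layer 2) (Units.mk0 ((ε : 𝓞 K) : K) hεK) := by
    congr 1
    apply Units.ext
    simp
  refine relIndex_unitsNorm_eq_one_of_rank_eq_one hodd hrank ⟨2, by rw [hL]; norm_num⟩ ?_ (neg_one_mem_map_norm_layer_two hK κ hκ) hnsq
  rw [heq]; exact hmem

end Layer

end Literature.NumberTheory.IwasawaTheory

end
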